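import Literature.MathematicalPhysics.QuantumFieldTheory.Balaban1983to89.B9Eq3105FamThreeLocCDiffWordsAt
import Literature.MathematicalPhysics.QuantumFieldTheory.Balaban1983to89.B9Eq3105FamThreeLocCDiffSplit
import Literature.MathematicalPhysics.QuantumFieldTheory.Balaban1983to89.B9Eq3105FamThreeLocCDiffAtoms
import Literature.MathematicalPhysics.QuantumFieldTheory.Balaban1983to89.B9Eq3105FamThreeLocDiffGOfEBlock
import Literature.MathematicalPhysics.QuantumFieldTheory.Balaban1983to89.B9Cor36DPDsCubeAtLocCfg

/-!
# `Balaban1983to89.B9Eq3105FamThreeLocCDiffEntry` — FAMILY 3 OF (3.105): THE RECORD's BINDER `hP3 □` (D2, the located `C`-difference word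
# `conj b((D_{U₁}·M_{χl}·G′_□(V′)(Q′*X⁻¹Q′(U₁) − Q′*_□X_□⁻¹Q′_□(V′))G′_□(V′)·M_{χl}·D*_{U₁})^ℝ) ≺ ε₃·ℓ(a)⁻²·e^{−ρd}` on the bond carrier) SUPPLIED FROM THE RECORD's OWN
# DATA (`hCinv`, `hE`, `hR`, the (3.35) datum, the units) MODULO DISPLAYED MEMBER-CARRIER MAJORANTS OF THE CUBE TAILS AND OUTER ENTRIES AT `V′ = Ṽ_□^{u⁻¹}`, with `ε₃`
# EXPLICIT — FILE F3-B3∕6 (sub-row G-B9-LETTERS, GAPS G-B9-05 family 3 (D2); programme FAMTHREE; record `B9Eq3105FamThreeLocDiffGOfEBlock.hasMajorant_sum_famThree_at_locCfg_chiL`)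

statement-level skeleton of published theorems with citation tags; proofs where landed; nothing here is a claim about the Yang–Mills mass gap

THE PRINTED LOCUS (held `paper:balaban1985-cmp99-background-propagators`, journal page = PDF page + 388).  p. 415 l. 26–37; p. 412 l. 1–9 + l. 22–36; (3.95) p. 411; (3.100)
p. 413 (the derivatives through the cut-offs); (3.48)–(3.49) pp. 398–399; (3.42) p. 397; (3.19)–(3.25) pp. 393–395; Cor. 3.6 p. 408; p. 408 (`χ_□`, `S_j`).  [4] =
`Balaban1984PropagatorsII` (2.51)–(2.61) pp. 232–234, (2.83)–(2.85) pp. 237–238.  [2] = `Balaban1983RegularityDecay` (1.11)–(1.12): STATEMENT TYPE ONLY (road ours).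

WHAT THIS FILE CERTIFIES (kernel-checked; 0 `def`, 0 `def … : Prop`, 0 sorry)

* ★★★ `hasMajorant_hP3_of_tails` — EXACTLY the record's `hP3 □` (bond carrier `(toB6 (geo9K i) Rr′ Hp, ι_B∘blkV1)`, kernel `ε₃·ℓ(a)⁻²·e^{−ρd}`), from: the record's (3.48)
  block `hCinv` (→ the member resolvent word, atoms A1), `hE` (→ `η²G′(U₁)`, p21 `hasMajorant_conj_G_of_eBlockInv`), the cube commutator datum `hR □` (→ `R_χ(V′)`, F3-E2b∕E2d
  `hasMajorant_commStep_member_rate`), the member projection (atoms `hasMajorant_conj_proj`), the (3.35) datum + the four units (→ FILE 2's identity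
  `cut_locCDiff_cut_eq_fourWords`), `η²η²s = 1` (the record's `hs`) — and DISPLAYED member-carrier majorants at `V′`: the left entries `conj(η⁻¹∇_μ)M_{χl}conj(η²G′_□(V′))`
  (rows located in `S_L = {blocks meeting NearC(21S_j∕8 + 1)}`, weight `ℓ`), the right entries `conj(η²G′_□(V′))M_{χl}conj(η⁻¹∇*_ν)` (weight `ℓ`), the tails
  `(η²G′_□)^k·sQ′*_□X_□⁻¹Q′_□(V′)·M₂·(right entry)` (`k = 0,1,2`; weights `ℓ⁻³, ℓ⁻¹, ℓ`), `M₂·sQ′*_□X_□⁻¹Q′_□(V′)` (near rows, `ℓ⁻⁴`), `sQ′*_□X_□⁻¹Q′_□(V′)·(right entry)` (`ℓ⁻³`) and the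
  cube projection `Q′*_□Q′_□(V′)` (block-local on the member carrier) — their suppliers are the cube data at `Ṽ_□` (p33 `gp_cube_at_locCfg`, p21 `cinv_cube_at_locCfg`) through
  (3.33) rotations and p38's sandwich transfers (FILE F3-B3∕7, next).  Mechanism: FILE 5 `hasMajorant_siteWord_of_letters` for every `(μ, ν)`, r06's derivative dictionary
  `B9Eq376DerivDict.hasMajorant_gradLin_comp_comp_divLin` (the factor `d + 1`) and p21's bond relabel `B9Cor36DPDsCubeAtLocCfg.hasMajorant_conj_gradMdiv_of_relabel`
  (`r = η⁻¹`, `r² = c_f²` by `η = |c_f|⁻¹`).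

HONEST SCOPE ∕ NOT CLAIMED.  Finite lattice algebra and [4]'s bookkeeping over landed modules; NO inequality of [B9] is proved here beyond what the displayed hypotheses
grant; `hP3` is supplied MODULO the displayed cube-tail ∕ outer-entry majorants (named suppliers, next file) — NOT discharged outright.  Count-neutral; NOT a node discharge;
nothing continuum ∕ OS ∕ mass-gap ∕ Clay; YM mass gap NOT proved (Track A conditional rung).  No `sorry`, no `axiom`, no `… : Prop` fact, no `instance`, no `notation`, no
`def`.  NEW file; nothing landed is modified.  Cell `lit-balaban`, seat `lit-balaban-p33` gen 104, 2026-08-29; `--supports stmt-QuantumFields-19200` as helper.  Net new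
unproved facts: 0.

RELATED IN THE TREE, NOT DUPLICATED (searched 2026-08-29: `rg 'hP3_of' Literature/` = ∅): FILES 2–5 of F3-B3 (`…LocCDiffSplit`, `…Atoms`, `…Chains`, `…WordsAt` — USED BY NAME),
p38 `B9Eq3105FamThreeLocDiffGRight.hasMajorant_hDR_at` (the `hDR` twin, modulo `hGK`), p33 `B9Eq3105FamThreeLocDiffGOfEBlock` (the record; `hasMajorant_commStep_member_rate`,
`restrict_smul_apply`), p21 `B9CubeLettersInvReadDict`, r06 `B9Eq376DerivDict`, p21 `B9Cor36DPDsCubeAtLocCfg`, `B9Eq346GradGpDivTorusL2.blkV1_eq_blkOf_chartY` (`rfl`).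
-/

noncomputable section

namespace Literature.MathematicalPhysics.QuantumFieldTheory.Balaban1983to89.B9Eq3105FamThreeLocCDiffEntry

open NormedSpace Complex
open B6RandomWalk (HasMajorant hasMajorant_mono Ineq261 c1_nonneg)
open B9Thm34Ext (toB6)
open B9Thm37Sum (mulOp mulOp_apply)
open B9FromB6 (EBlock)
open B9Ineq347 (ScaleTransfer)
open B9Eq352DivFormLetters (conj)
open B9Eq352GradLetters (diffLetter)
open B9Eq376POneLetters (conjHom gradLin divLin)
open B9Eq376DerivDict (hasMajorant_gradLin_comp_comp_divLin)
open B9Eq39Adjoint (fluct)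
open B9Eq360DeltaPrimeAY (AfldY)
open B9Eq360DeltaPrimeACubeY (blkCubeY)
open B6KLevelCensusIndexV1 (KIdx kGeo)
open B6Cover236MultiLevelBlocks (cubes)
open B6GlobalChartV1 (PV boxEquiv blkV1)
open B6Geom246MultiLevelBox (blkOf)
open B6Ineq2142KLevelV1 (β)
open B9GeoNormsKLevelV1 (geo9K)
open B9GeoLemma21KLevelV1 (geo9K_len_pos)
open B9CubeGeometryInputs (geoCK)
open B9CubeLettersOpsL0 (deltaPrimeACubeY GpCubeY)
open B9CubeLettersBondOpsL0 (QpCubeY QpsCubeY XCubeY XinvCubeY)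
open B9CubeLettersInvReadings (kernelFamilySInv)
open B9CubeLettersInvReadDict (hasMajorant_conj_G_of_eBlockInv)
open B9Thm37CubeCoverCommutators (cutMulY cutMulY_apply)
open B9Cor36CutoffField337 (bumpY)
open B9Cor36CubeCutoffs (SC NearC chiY ctrR locCfgY one_le_SC)
open B9Eq3105FamTwoCore (geo9K_axioms)
open B9Eq3105FamThreeLocDiffGOfEBlock (hasMajorant_commStep_member_rate restrict_smul_apply)
open B9Eq3105FamThreeLocCDiffSplit (cut_locCDiff_cut_eq_fourWords)
open B9Eq3105FamThreeLocCDiffAtoms (hasMajorant_conj_resolventWord hasMajorant_conj_proj)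
open B9Eq3105FamThreeLocCDiffWordsAt (hasMajorant_siteWord_of_letters)
open B9Cor36DPDsCubeAtLocCfg (hasMajorant_conj_gradMdiv_of_relabel)
open Node00 (SiteY BlkY IBondY FBondY CfgY GaugeY toKT shiftY UboxY GpY deltaPrimeAY gaugeY parSymY etaS QpY QpsY XY XinvY gradY divY)
open Node00.OpsYNablaBridge (chartY)

variable {d ℓ : ℕ} {hd : 1 ≤ d + 1} {hL : Odd (ℓ + 1) ∧ 1 < ℓ + 1} {b₀ b₁ : ℝ}
variable {𝔸 : Type} [NormedRing 𝔸] [NormedAlgebra ℂ 𝔸] [CompleteSpace 𝔸]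
variable {ι : Type} [Fintype ι]
variable (i : KIdx d ℓ hd hL b₀ b₁) (c : ↥(cubes (toKT i).D.toDomains)) (b : Module.Basis ι ℝ 𝔸)

section Entry

variable [Fintype (geo9K i).Site] [DecidableEq (geo9K i).Site] {Rr : ℝ} {H : Prop} {Rr' : ℝ} {Hp : Prop}
variable {B : B9.Backgrounds} (cfg : B.Cfg → CfgY 𝔸 i) {U₁ : B.Cfg}

omit [Fintype (geo9K i).Site] [DecidableEq (geo9K i).Site] in
/-- `3S_j ≤ 7S_j∕2`. [cite: Balaban1985BackgroundPropagators, p.408, bookkeeping] -/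
theorem three_SC_le_seven_halves : 3 * SC i c ≤ 7 * SC i c / 2 := by have := one_le_SC i c; omega

open Classical in
set_option maxHeartbeats 6400000 in
/-- ★★★ **THE RECORD's `hP3 □` FROM ITS OWN DATA, MODULO DISPLAYED CUBE TAILS ∕ OUTER ENTRIES AT `V′ = Ṽ_□^{u⁻¹}`** — see the module docstring for the list of
inputs and suppliers; the conclusion is LITERALLY the binder `hP3 c` of `B9Eq3105FamThreeLocDiffGOfEBlock.hasMajorant_sum_famThree_at_locCfg_chiL` with
`ε₃ = (d + 1)·ε_{P3}` (`ε_{P3}` = FILE 5's explicit sum of eight collar-small constants) and `ρ = r₀ − 5(α + β)δ₀ − a_sep`.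
[cite: Balaban1985BackgroundPropagators, p.415 l.26–37, p.412 l.1–9 + l.22–36, (3.95) p.411, (3.100) p.413, (3.48)–(3.49) pp.398–399, (3.42) p.397, (3.25) pp.394–395, Cor. 3.6 p.408; Balaban1983RegularityDecay, (1.11)–(1.12) (statement type); Balaban1984PropagatorsII, (2.51)–(2.61) pp.232–234, (2.83)–(2.85) pp.237–238] -/
theorem hasMajorant_hP3_of_tails
    {BG δG : ℝ} (hE : EBlock (kernelFamilySInv i B cfg (fun W => GpY i (parSymY i) W) (parSymY i)) BG δG U₁) (hBG : 0 ≤ BG)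
    (ιB : BlkY i → IBondY i) (hι : ∀ s, β i.hN i.D i.hk (ιB s) = s)
    (hpar : ∀ z w : SiteY i, ‖(parSymY i (cfg U₁) z w : 𝔸)‖ ≤ 1 ∧ ‖(((parSymY i (cfg U₁) z w)⁻¹ : 𝔸ˣ) : 𝔸)‖ ≤ 1)
    {M₂ : ℝ} (hM₂ : 0 ≤ M₂) (hrepr : ∀ (v : 𝔸) (j : ι), |b.repr v j| ≤ M₂ * ‖v‖) (hη : etaS i = |i.cf|⁻¹)
    {s B₁ δX : ℝ} (hs : (etaS i ^ 2 * etaS i ^ 2) * s = 1) (hB₁ : 0 ≤ B₁)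
    (hCinv : HasMajorant (g := toB6 (geo9K i) Rr' Hp) (fun q : BlkY i × ι => ιB q.1) (conj b (s • (XinvY i (parSymY i) (fun W => GpY i (parSymY i) W) (cfg U₁)).restrictScalars ℝ))
      (fun a a' => B₁ * ((geo9K i).len a ^ 4)⁻¹ * Real.exp (-(δX * (geo9K i).dist a a'))))
    (u : GaugeY 𝔸 i) (hu : ∀ x, ‖((u x : 𝔸ˣ) : 𝔸)‖ ≤ 1 ∧ ‖(((u x)⁻¹ : 𝔸ˣ) : 𝔸)‖ ≤ 1) (A : AfldY 𝔸 i) (Q : Set (Site (PV d ℓ i.m i.K hd hL) 0)) (η : ℝ)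
    (hQ : ∀ x : Site (PV d ℓ i.m i.K hd hL) 0, NearC i c (35 * SC i c / 8 + 1) (boxEquiv i.hN x).1 → x ∈ Q)
    (hgA : ∀ (κ : Fin (d + 1)) (x : Site (PV d ℓ i.m i.K hd hL) 0), x ∈ Q → x.shift κ ∈ Q → gaugeY i u (cfg U₁) κ x = fluct η A κ x)
    (hX : IsUnit (XY i (parSymY i) (fun W => GpY i (parSymY i) W) (cfg U₁)))
    (hXc : IsUnit (XCubeY i c (parSymY i) (gaugeY i u⁻¹ (locCfgY i c η A))))
    (hU : IsUnit (deltaPrimeAY i (parSymY i) (cfg U₁))) (hV : IsUnit (deltaPrimeACubeY i c (parSymY i) (gaugeY i u⁻¹ (locCfgY i c η A))))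
    (dBc : ℕ) {θ δc αc bb : ℝ} (hθ : 0 ≤ θ) (hδc : 0 ≤ δc) (hαc1 : αc ≤ 1) (hrate : bb * δG ≤ (1 - αc) * δc)
    (h261c : Ineq261 dBc (toB6 (geoCK i c) Rr H) δc αc)
    (hR : HasMajorant (g := toB6 (geoCK i c) Rr H) (fun p : SiteY i × ι => blkCubeY i c p.1)
      (conj b (((cutMulY (𝔸 := 𝔸) (chiY i c) * deltaPrimeACubeY i c (parSymY i) (locCfgY i c η A) -
          deltaPrimeACubeY i c (parSymY i) (locCfgY i c η A) * cutMulY (𝔸 := 𝔸) (chiY i c)) * GpCubeY i c (parSymY i) (locCfgY i c η A)).restrictScalars ℝ))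
      (fun a s' => θ * Real.exp (-(δc * (geoCK i c).dist a s'))))
    (dB : ℕ) {κL κPb κT0 κT1 κT2 κSb κR κG r₀ rT0 rT1 rT2 rSb rR rG δ₀ α β' asep CS CA CT3 CT1 C1 : ℝ}
    (hκL : 0 ≤ κL) (hκPb : 0 ≤ κPb) (hκT0 : 0 ≤ κT0) (hκT1 : 0 ≤ κT1) (hκT2 : 0 ≤ κT2) (hκSb : 0 ≤ κSb) (hκR : 0 ≤ κR) (hκG : 0 ≤ κG)
    (hCS : 0 ≤ CS) (hCA : 0 ≤ CA) (hCT3 : 0 ≤ CT3) (hCT1 : 0 ≤ CT1) (hC1 : 0 ≤ C1)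
    (hαδ : 0 ≤ α * δ₀) (hε0 : 0 ≤ (α + β') * δ₀) (hasep : 0 ≤ asep) (hρ : 0 ≤ r₀ - 5 * ((α + β') * δ₀) - asep)
    (hrS : r₀ - (α + β') * δ₀ ≤ δX) (hrA : r₀ - 2 * ((α + β') * δ₀) ≤ δG) (hrc : r₀ - 3 * ((α + β') * δ₀) - asep ≤ bb * δG)
    (hrT0 : r₀ - 4 * ((α + β') * δ₀) - asep ≤ rT0) (hrT1 : r₀ - 4 * ((α + β') * δ₀) - asep ≤ rT1) (hrT2 : r₀ - 2 * ((α + β') * δ₀) - asep ≤ rT2)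
    (hrSb : r₀ - (α + β') * δ₀ ≤ rSb) (hrR : r₀ - 2 * ((α + β') * δ₀) - asep ≤ rR) (hrG : r₀ - 5 * ((α + β') * δ₀) - asep ≤ rG)
    (hST4 : ScaleTransfer (geo9K i) δ₀ α CS (fun a => ((geo9K i).len a ^ 4)⁻¹)) (hST2 : ScaleTransfer (geo9K i) δ₀ α CA (fun a => (geo9K i).len a ^ 2))
    (hST3 : ScaleTransfer (geo9K i) δ₀ α CT3 (fun a => ((geo9K i).len a ^ 3)⁻¹)) (hSTm1 : ScaleTransfer (geo9K i) δ₀ α CT1 (fun a => ((geo9K i).len a)⁻¹))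
    (hST1 : ScaleTransfer (geo9K i) δ₀ α C1 (fun a => (geo9K i).len a)) (h261 : Ineq261 dB (toB6 (geo9K i) Rr' Hp) δ₀ β')
    -- the displayed member-carrier inputs at `V′` (suppliers: FILE F3-B3∕7)
    (hL : ∀ μ : Fin (d + 1), HasMajorant (g := toB6 (geo9K i) Rr' Hp) (fun p : SiteY i × ι => ιB (blkOf i.D.toDomains p.1))
      (conj b (diffLetter (shiftY i) (UboxY i (cfg U₁)) (((etaS i : ℝ) : ℂ))⁻¹ (Sum.inl μ)) * mulOp (fun p : SiteY i × ι => bumpY i (ctrR i c) (3 * (SC i c : ℝ)) p.1) *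
        conj b (((((etaS i ^ 2 : ℝ) : ℂ)) • GpCubeY i c (parSymY i) (gaugeY i u⁻¹ (locCfgY i c η A))).restrictScalars ℝ))
      (fun a a' : (geo9K i).Site => (if a ∈ (Finset.univ.filter fun a : (geo9K i).Site => ∃ z : SiteY i, ιB (blkOf i.D.toDomains z) = a ∧ NearC i c (21 * SC i c / 8 + 1) z.1)
        then (1 : ℝ) else 0) * (κL * (geo9K i).len a * Real.exp (-(r₀ * (geo9K i).dist a a')))))
    (hRop : ∀ ν : Fin (d + 1), HasMajorant (g := toB6 (geo9K i) Rr' Hp) (fun p : SiteY i × ι => ιB (blkOf i.D.toDomains p.1))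
      (conj b (((((etaS i ^ 2 : ℝ) : ℂ)) • GpCubeY i c (parSymY i) (gaugeY i u⁻¹ (locCfgY i c η A))).restrictScalars ℝ) *
        mulOp (fun p : SiteY i × ι => bumpY i (ctrR i c) (3 * (SC i c : ℝ)) p.1) * conj b (diffLetter (shiftY i) (UboxY i (cfg U₁)) (((etaS i : ℝ) : ℂ))⁻¹ (Sum.inr ν)))
      (fun a a' => κR * (geo9K i).len a * Real.exp (-(rR * (geo9K i).dist a a'))))
    (hTail0 : ∀ ν : Fin (d + 1), HasMajorant (g := toB6 (geo9K i) Rr' Hp) (fun p : SiteY i × ι => ιB (blkOf i.D.toDomains p.1))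
      (conj b ((((s : ℝ) : ℂ) • (QpsCubeY i c (parSymY i) (gaugeY i u⁻¹ (locCfgY i c η A)) ∘ₗ XinvCubeY i c (parSymY i) (gaugeY i u⁻¹ (locCfgY i c η A)) ∘ₗ
          QpCubeY i c (parSymY i) (gaugeY i u⁻¹ (locCfgY i c η A)))).restrictScalars ℝ) *
        mulOp (fun p : SiteY i × ι => if NearC i c (3 * SC i c) p.1.1 then (1 : ℝ) else 0) *
        (conj b (((((etaS i ^ 2 : ℝ) : ℂ)) • GpCubeY i c (parSymY i) (gaugeY i u⁻¹ (locCfgY i c η A))).restrictScalars ℝ) *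
          mulOp (fun p : SiteY i × ι => bumpY i (ctrR i c) (3 * (SC i c : ℝ)) p.1) * conj b (diffLetter (shiftY i) (UboxY i (cfg U₁)) (((etaS i : ℝ) : ℂ))⁻¹ (Sum.inr ν))))
      (fun a a' => κT0 * ((geo9K i).len a ^ 3)⁻¹ * Real.exp (-(rT0 * (geo9K i).dist a a'))))
    (hTail1 : ∀ ν : Fin (d + 1), HasMajorant (g := toB6 (geo9K i) Rr' Hp) (fun p : SiteY i × ι => ιB (blkOf i.D.toDomains p.1))
      (conj b (((((etaS i ^ 2 : ℝ) : ℂ)) • GpCubeY i c (parSymY i) (gaugeY i u⁻¹ (locCfgY i c η A))).restrictScalars ℝ) *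
        (conj b ((((s : ℝ) : ℂ) • (QpsCubeY i c (parSymY i) (gaugeY i u⁻¹ (locCfgY i c η A)) ∘ₗ XinvCubeY i c (parSymY i) (gaugeY i u⁻¹ (locCfgY i c η A)) ∘ₗ
            QpCubeY i c (parSymY i) (gaugeY i u⁻¹ (locCfgY i c η A)))).restrictScalars ℝ) *
          mulOp (fun p : SiteY i × ι => if NearC i c (3 * SC i c) p.1.1 then (1 : ℝ) else 0) *
          (conj b (((((etaS i ^ 2 : ℝ) : ℂ)) • GpCubeY i c (parSymY i) (gaugeY i u⁻¹ (locCfgY i c η A))).restrictScalars ℝ) *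
            mulOp (fun p : SiteY i × ι => bumpY i (ctrR i c) (3 * (SC i c : ℝ)) p.1) * conj b (diffLetter (shiftY i) (UboxY i (cfg U₁)) (((etaS i : ℝ) : ℂ))⁻¹ (Sum.inr ν)))))
      (fun a a' => κT1 * ((geo9K i).len a)⁻¹ * Real.exp (-(rT1 * (geo9K i).dist a a'))))
    (hTail2 : ∀ ν : Fin (d + 1), HasMajorant (g := toB6 (geo9K i) Rr' Hp) (fun p : SiteY i × ι => ιB (blkOf i.D.toDomains p.1))
      (conj b (((((etaS i ^ 2 : ℝ) : ℂ)) • GpCubeY i c (parSymY i) (gaugeY i u⁻¹ (locCfgY i c η A))).restrictScalars ℝ) *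
        conj b (((((etaS i ^ 2 : ℝ) : ℂ)) • GpCubeY i c (parSymY i) (gaugeY i u⁻¹ (locCfgY i c η A))).restrictScalars ℝ) *
        (conj b ((((s : ℝ) : ℂ) • (QpsCubeY i c (parSymY i) (gaugeY i u⁻¹ (locCfgY i c η A)) ∘ₗ XinvCubeY i c (parSymY i) (gaugeY i u⁻¹ (locCfgY i c η A)) ∘ₗ
            QpCubeY i c (parSymY i) (gaugeY i u⁻¹ (locCfgY i c η A)))).restrictScalars ℝ) *
          mulOp (fun p : SiteY i × ι => if NearC i c (3 * SC i c) p.1.1 then (1 : ℝ) else 0) *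
          (conj b (((((etaS i ^ 2 : ℝ) : ℂ)) • GpCubeY i c (parSymY i) (gaugeY i u⁻¹ (locCfgY i c η A))).restrictScalars ℝ) *
            mulOp (fun p : SiteY i × ι => bumpY i (ctrR i c) (3 * (SC i c : ℝ)) p.1) * conj b (diffLetter (shiftY i) (UboxY i (cfg U₁)) (((etaS i : ℝ) : ℂ))⁻¹ (Sum.inr ν)))))
      (fun a a' => κT2 * (geo9K i).len a * Real.exp (-(rT2 * (geo9K i).dist a a'))))
    (hSbL : HasMajorant (g := toB6 (geo9K i) Rr' Hp) (fun p : SiteY i × ι => ιB (blkOf i.D.toDomains p.1))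
      (mulOp (fun p : SiteY i × ι => if NearC i c (3 * SC i c) p.1.1 then (1 : ℝ) else 0) *
        conj b ((((s : ℝ) : ℂ) • (QpsCubeY i c (parSymY i) (gaugeY i u⁻¹ (locCfgY i c η A)) ∘ₗ XinvCubeY i c (parSymY i) (gaugeY i u⁻¹ (locCfgY i c η A)) ∘ₗ
          QpCubeY i c (parSymY i) (gaugeY i u⁻¹ (locCfgY i c η A)))).restrictScalars ℝ))
      (fun a a' => κSb * ((geo9K i).len a ^ 4)⁻¹ * Real.exp (-(rSb * (geo9K i).dist a a'))))
    (hG : ∀ ν : Fin (d + 1), HasMajorant (g := toB6 (geo9K i) Rr' Hp) (fun p : SiteY i × ι => ιB (blkOf i.D.toDomains p.1))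
      (conj b ((((s : ℝ) : ℂ) • (QpsCubeY i c (parSymY i) (gaugeY i u⁻¹ (locCfgY i c η A)) ∘ₗ XinvCubeY i c (parSymY i) (gaugeY i u⁻¹ (locCfgY i c η A)) ∘ₗ
          QpCubeY i c (parSymY i) (gaugeY i u⁻¹ (locCfgY i c η A)))).restrictScalars ℝ) *
        (conj b (((((etaS i ^ 2 : ℝ) : ℂ)) • GpCubeY i c (parSymY i) (gaugeY i u⁻¹ (locCfgY i c η A))).restrictScalars ℝ) *
          mulOp (fun p : SiteY i × ι => bumpY i (ctrR i c) (3 * (SC i c : ℝ)) p.1) * conj b (diffLetter (shiftY i) (UboxY i (cfg U₁)) (((etaS i : ℝ) : ℂ))⁻¹ (Sum.inr ν))))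
      (fun a a' => κG * ((geo9K i).len a ^ 3)⁻¹ * Real.exp (-(rG * (geo9K i).dist a a'))))
    (hPb : HasMajorant (g := toB6 (geo9K i) Rr' Hp) (fun p : SiteY i × ι => ιB (blkOf i.D.toDomains p.1))
      (conj b ((QpsCubeY i c (parSymY i) (gaugeY i u⁻¹ (locCfgY i c η A)) ∘ₗ QpCubeY i c (parSymY i) (gaugeY i u⁻¹ (locCfgY i c η A))).restrictScalars ℝ))
      (fun a a' : (geo9K i).Site => if a = a' then κPb else 0)) :
    HasMajorant (g := toB6 (geo9K i) Rr' Hp) (fun p : FBondY i × ι => ιB (blkV1 i.hN i.D p.1))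
      (conj b ((gradY i (cfg U₁) ∘ₗ (cutMulY (𝔸 := 𝔸) (bumpY i (ctrR i c) (3 * (SC i c : ℝ))) ∘ₗ
        (GpCubeY i c (parSymY i) (gaugeY i u⁻¹ (locCfgY i c η A)) ∘ₗ
          ((QpsY i (parSymY i) (cfg U₁) ∘ₗ XinvY i (parSymY i) (fun W => GpY i (parSymY i) W) (cfg U₁) ∘ₗ QpY i (parSymY i) (cfg U₁))
            - (QpsCubeY i c (parSymY i) (gaugeY i u⁻¹ (locCfgY i c η A)) ∘ₗ
                XinvCubeY i c (parSymY i) (gaugeY i u⁻¹ (locCfgY i c η A)) ∘ₗ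
                QpCubeY i c (parSymY i) (gaugeY i u⁻¹ (locCfgY i c η A)))) ∘ₗ
          GpCubeY i c (parSymY i) (gaugeY i u⁻¹ (locCfgY i c η A))) ∘ₗ
        cutMulY (𝔸 := 𝔸) (bumpY i (ctrR i c) (3 * (SC i c : ℝ)))) ∘ₗ divY i (cfg U₁)).restrictScalars ℝ))
      (fun a y => ((d : ℝ) + 1) *
          (κL * ((M₂ * ∑ j, ‖b j‖) ^ 2 * B₁) * κPb * κT2 * (CS * C1) * B6.c1 dB δ₀ β' ^ 2 * Real.exp (-(asep * (3 / 8 * (i.Mh : ℝ) - 1))) +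
            κL * ((M₂ * ∑ j, ‖b j‖) ^ 2 * B₁) * (M₂ * (∑ j, ‖b j‖) * BG) ^ 2 * (M₂ * ∑ j, ‖b j‖) ^ 2 * κT0 * (CS * CA ^ 2 * CT3) * B6.c1 dB δ₀ β' ^ 4 *
              Real.exp (-(asep * (3 / 8 * (i.Mh : ℝ) - 1))) +
            κL * ((M₂ * ∑ j, ‖b j‖) ^ 2 * B₁) * (M₂ * (∑ j, ‖b j‖) * BG) ^ 2 * ((M₂ * ∑ j, ‖b j‖) ^ 2 * (θ * B6.c1 dBc δc αc)) * κT0 * (CS * CA ^ 2 * CT3) *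
              B6.c1 dB δ₀ β' ^ 5 * Real.exp (-(asep * (3 / 8 * (i.Mh : ℝ) - 2))) +
            κL * ((M₂ * ∑ j, ‖b j‖) ^ 2 * B₁) * (M₂ * (∑ j, ‖b j‖) * BG) * ((M₂ * ∑ j, ‖b j‖) ^ 2 * (θ * B6.c1 dBc δc αc)) * κT1 * (CS * CA * CT1) *
              B6.c1 dB δ₀ β' ^ 4 * Real.exp (-(asep * (3 / 8 * (i.Mh : ℝ) - 2))) +
            κL * ((M₂ * ∑ j, ‖b j‖) ^ 2 * B₁) * κR * (CS * C1) * B6.c1 dB δ₀ β' ^ 2 * Real.exp (-(asep * (3 / 8 * (i.Mh : ℝ) - 1))) +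
            κL * κSb * κR * (CS * C1) * B6.c1 dB δ₀ β' ^ 2 * Real.exp (-(asep * (3 / 8 * (i.Mh : ℝ) - 1))) +
            κL * Real.exp (-(asep * (3 / 8 * (i.Mh : ℝ) - 1))) * (((M₂ * ∑ j, ‖b j‖) ^ 2 * B₁) * κR * C1 * B6.c1 dB δ₀ β') * CT3 * B6.c1 dB δ₀ β' +
            κL * Real.exp (-(asep * (3 / 8 * (i.Mh : ℝ) - 1))) * κG * CT3 * B6.c1 dB δ₀ β') *
        ((geo9K i).len a ^ 2)⁻¹ * Real.exp (-((r₀ - 5 * ((α + β') * δ₀) - asep) * (geo9K i).dist a y))) := by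
  have hSum : 0 ≤ M₂ * ∑ j, ‖b j‖ := mul_nonneg hM₂ (Finset.sum_nonneg fun j _ => norm_nonneg _)
  set V' : CfgY 𝔸 i := gaugeY i u⁻¹ (locCfgY i c η A) with hV'
  set χl : SiteY i → ℝ := bumpY i (ctrR i c) (3 * (SC i c : ℝ)) with hχl
  set ind : SiteY i → ℝ := fun z => if NearC i c (3 * SC i c) z.1 then (1 : ℝ) else 0 with hind
  set Bc : Module.End ℂ (SiteY i → 𝔸) := GpCubeY i c (parSymY i) V' with hBc
  set S : Module.End ℂ (SiteY i → 𝔸) := QpsY i (parSymY i) (cfg U₁) ∘ₗ XinvY i (parSymY i) (fun W => GpY i (parSymY i) W) (cfg U₁) ∘ₗ QpY i (parSymY i) (cfg U₁) with hS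
  set Sb : Module.End ℂ (SiteY i → 𝔸) := QpsCubeY i c (parSymY i) V' ∘ₗ XinvCubeY i c (parSymY i) V' ∘ₗ QpCubeY i c (parSymY i) V' with hSb
  set e : ℂ := (((etaS i ^ 2 : ℝ) : ℂ)) with he
  set σ : ℂ := ((s : ℝ) : ℂ) with hσdef
  set S_L : Finset (geo9K i).Site := Finset.univ.filter fun a : (geo9K i).Site => ∃ z : SiteY i, ιB (blkOf i.D.toDomains z) = a ∧ NearC i c (21 * SC i c / 8 + 1) z.1
    with hS_L
  have hSL : ∀ a ∈ S_L, ∃ z : SiteY i, ιB (blkOf i.D.toDomains z) = a ∧ NearC i c (21 * SC i c / 8 + 1) z.1 := fun a ha => (Finset.mem_filter.1 ha).2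
  -- the scalars: `e·e·σ = 1`
  have hσ : e * e * σ = 1 := by
    rw [he, hσdef]; exact_mod_cast hs
  -- FILE 2's four-word identity at the pair, for the sharp cut-off `𝟙[NearC 3S_j]`
  have h4 := cut_locCDiff_cut_eq_fourWords i c u (cfg U₁) η A hQ hgA hX hXc hU hV ind ind (three_SC_le_seven_halves i c)
    (fun z hz => by by_contra h; exact hz (by simp only [hind]; rw [if_neg h])) (fun z hz => by by_contra h; exact hz (by simp only [hind]; rw [if_neg h]))
  -- the member letters from the record's data
  have hSm := hasMajorant_conj_resolventWord i b ιB (parSymY i) (fun W => GpY i (parSymY i) W) (cfg U₁) (Rr := Rr') (Hp := Hp) hpar hM₂ hrepr hB₁ hCinv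
  rw [show (s • S : Module.End ℂ (SiteY i → 𝔸)) = σ • S from (algebraMap_smul ℂ s S).symm] at hSm
  have hAm := hasMajorant_conj_G_of_eBlockInv i b cfg (fun W => GpY i (parSymY i) W) (parSymY i) (Rr := Rr') (Hp := Hp) hE hBG ιB hι hM₂ hrepr (η := etaS i) rfl
    ((e • GpY i (parSymY i) (cfg U₁)).restrictScalars ℝ) (fun Λ => restrict_smul_apply i (etaS i) _ Λ)
  have hRcm := hasMajorant_commStep_member_rate i c b (Rr := Rr) (H := H) (Rr' := Rr') (Hp := Hp) hM₂ hrepr u hu (locCfgY i c η A) ιB hι dBc hθ hδc hαc1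
    hrate h261c hR
  have hPm := hasMajorant_conj_proj i b ιB (parSymY i) (cfg U₁) (Rr := Rr') (Hp := Hp) hpar hM₂ hrepr
  -- every `(μ, ν)` entry of the located site word (FILE 5)
  have hsite : ∀ μ ν : Fin (d + 1), HasMajorant (g := toB6 (geo9K i) Rr' Hp) (fun p : SiteY i × ι => ιB (blkOf i.D.toDomains p.1))
      (conj b (diffLetter (shiftY i) (UboxY i (cfg U₁)) (((etaS i : ℝ) : ℂ))⁻¹ (Sum.inl μ)) *
        conj b ((cutMulY (𝔸 := 𝔸) χl * (Bc * (S - Sb) * Bc) * cutMulY (𝔸 := 𝔸) χl).restrictScalars ℝ) *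
        conj b (diffLetter (shiftY i) (UboxY i (cfg U₁)) (((etaS i : ℝ) : ℂ))⁻¹ (Sum.inr ν))) _ := fun μ ν =>
    hasMajorant_siteWord_of_letters i c b (Rr' := Rr') (Hp := Hp) ιB hι V' S_L hSL _ _ Bc S Sb (GpY i (parSymY i) (cfg U₁))
      (QpsY i (parSymY i) (cfg U₁) ∘ₗ QpY i (parSymY i) (cfg U₁)) (QpsCubeY i c (parSymY i) V' ∘ₗ QpCubeY i c (parSymY i) V') hσ h4 dB
      hκL (mul_nonneg (sq_nonneg _) hB₁) (mul_nonneg hSum hBG) (mul_nonneg (sq_nonneg _) (mul_nonneg hθ (c1_nonneg _ _ _))) (sq_nonneg _)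
      hκPb hκT0 hκT1 hκT2 hκSb hκR hκG hCS hCA hCT3 hCT1 hC1 hαδ hε0 hasep hρ
      hrS hrA hrc hrT0 hrT1 hrT2 hrSb hrR hrG hST4 hST2 hST3 hSTm1 hST1 h261 (hL μ) hSm hAm hRcm hPm hPb (hTail0 ν) (hTail1 ν) (hTail2 ν) hSbL (hRop ν) (hG ν)
  -- the derivative dictionary: all `(μ, ν)` at once, then the bond relabel
  have hdd := hasMajorant_gradLin_comp_comp_divLin (g := geo9K i) (R := Rr') (H := Hp) b (T := shiftY i) (V := UboxY i (cfg U₁))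
    (fun z : SiteY i => ιB (blkOf i.D.toDomains z)) (((etaS i : ℝ) : ℂ))⁻¹
    (P := conj b ((cutMulY (𝔸 := 𝔸) χl * (Bc * (S - Sb) * Bc) * cutMulY (𝔸 := 𝔸) χl).restrictScalars ℝ)) fun μ ν => hsite μ ν
  have hM : (cutMulY (𝔸 := 𝔸) χl * (Bc * (S - Sb) * Bc) * cutMulY (𝔸 := 𝔸) χl : Module.End ℂ (SiteY i → 𝔸)) =
      cutMulY (𝔸 := 𝔸) χl ∘ₗ (Bc ∘ₗ (S - Sb) ∘ₗ Bc) ∘ₗ cutMulY (𝔸 := 𝔸) χl := LinearMap.ext fun _ => rfl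
  rw [hM, ← Complex.ofReal_inv] at hdd
  have hr : ((etaS i)⁻¹) ^ 2 = i.cf ^ 2 := by rw [hη, inv_inv, sq_abs]
  have hrel := hasMajorant_conj_gradMdiv_of_relabel b i (g := geo9K i) (Rr := Rr') (H := Hp) (fun z : SiteY i => ιB (blkOf i.D.toDomains z)) (cfg U₁)
    (cutMulY (𝔸 := 𝔸) χl ∘ₗ (Bc ∘ₗ (S - Sb) ∘ₗ Bc) ∘ₗ cutMulY (𝔸 := 𝔸) χl) hr hdd
  refine hasMajorant_mono (g := toB6 (geo9K i) Rr' Hp) _ hrel fun a y => le_of_eq ?_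
  simp only [Fintype.card_fin, Nat.cast_add, Nat.cast_one]
  ring

end Entry

end Literature.MathematicalPhysics.QuantumFieldTheory.Balaban1983to89.B9Eq3105FamThreeLocCDiffEntry
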